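import Summits.CriticalPhenomena.SAWScalingLimit.Theorems.SAWDevelopingMapNoFoldBoundSealedClasses
import Summits.CriticalPhenomena.SAWScalingLimit.Theorems.SAWDevelopingMapNoFoldBoundSealedAlgebra

/-!
# Winding classes at a depth-two vertex (three rigid classes)

Helper file for the crux `NoFoldBound` (stmt-CriticalPhenomena-8296), route `SAWDevelopingMap`,
line `Ideator3Sketch`, open stub `stub_slitCoherence`. Infrastructure for the residual interior
stratum: at an interior vertex `v` (off the source, all neighbours inside) that has a neighbour
`w` TOUCHING the complement (`w ∼ x`, `x ∉ Λ`; `w` off the source mid-edge; `y` the third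
neighbour of `w`, inside or outside), EVERY first arrival at `v` has a rigid winding:

* a first arrival through a port `p ≠ w` cannot visit `w` (`notMem_of_touching`: a visit of `w`
  in the middle of the walk needs two distinct neighbours of `w` inside `Λ` other than `v`, but
  only `y` is available), so the double door extension through `v`, `w` to the boundary mid-edge
  `{w, x}` applies (`classes_of_notMem`, the proof of `sealed_classes` with the non-visit as a
  hypothesis): `W(γ) + W(p → v → w) = W(γ') + W(p' → v → w)` for ports `p, p' ≠ w`
  (`depthTwo_classes`);
* a first arrival `γ_w` through the port `w` itself arrives from `y`; re-targeting its last
  half-edge to the door `{w, x}` gives a walk to the boundary with winding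
  `W(γ_w) − turn(y, w → v) + turn(y, w → x)`, again rigid (`depthTwo_portClass`).

Hence at depth two the first arrivals occupy exactly three consecutive winding classes, one per
port, and the no-fold inequality there is a statement about the three REAL dressed port masses
only (the "middle-port starvation" criterion of the line card). Nothing here is specific to a
sealed `w`; the sealed case (`y ∉ Λ`, two live classes) is `SealedClasses`/`SealedPort`.
-/

noncomputable section

open scoped BigOperators
open Literature.Probability.LatticeModels Literature.Probability.RandomPlanarGeometry.SAW

namespace Summit.CriticalPhenomena.SAWScalingLimit.Theorems.SAWDevelopingMapNoFoldBound

variable {Λ : Finset HexVertex} {a : Sym2 HexVertex} {v w x y p : HexVertex}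

/-! ### A neighbour touching the complement is not traversed -/

/-- **Non-visit.** Let `w` be a neighbour of `v` with neighbours `v, x, y` (pairwise distinct),
`x ∉ Λ`, and `w` off the source mid-edge `a`. A first arrival `γ` at `v` through a port `p ≠ w`
(`v ∉ γ`) does not visit `w`: `w` is neither the last vertex (`p ≠ w`) nor the first (`w ∉ a`),
and an interior visit would have a predecessor and a successor, two DISTINCT neighbours of `w`
inside `Λ` other than `v` — both would be `y`. [folklore] -/
theorem notMem_of_touching (hva : v ∉ a) (hwa : w ∉ a) (hwv : hexGraph.Adj w v)
    (hwx : hexGraph.Adj w x) (hwy : hexGraph.Adj w y) (hvx : v ≠ x) (hxy : x ≠ y) (hvy : v ≠ y)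
    (hx : x ∉ Λ) (hpw : p ≠ w) (γ : HexMidEdgeSAW Λ a s(v, p)) (hvγ : v ∉ γ.verts) :
    w ∉ γ.verts := by
  intro hw
  obtain ⟨L₁, L₂, hL⟩ := List.append_of_mem hw
  have hlast := arrival_getLast?_eq hva γ hvγ
  -- a neighbour of `w` inside `Λ` on the walk is `y`
  have key : ∀ q : HexVertex, hexGraph.Adj w q → q ∈ γ.verts → q = y := by
    intro q hq hqγ
    have hqΛ : q ∈ Λ := γ.subset q hqγ
    rcases adj_cases hwv hwx hwy hvx hxy hvy hq with rfl | rfl | rfl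
    · exact absurd hqγ hvγ
    · exact absurd hqΛ hx
    · rfl
  rcases L₂ with _ | ⟨q, L₂⟩
  · -- `w` would be the last vertex `p`
    rw [hL, List.getLast?_append, List.getLast?_singleton, Option.some_or,
      Option.some.injEq] at hlast
    exact hpw hlast.symm
  · -- successor `q = y`
    have hch := γ.isChain
    rw [hL] at hch
    have hwq : hexGraph.Adj w q := (List.isChain_cons_cons.1 (List.isChain_append.1 hch).2.1).1
    have hqy : q = y := key q hwq (by rw [hL]; simp)
    rcases L₁.eq_nil_or_concat with h0 | ⟨L₁', r, h0⟩
    · -- `w` would be the head, on `a`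
      rw [h0, List.nil_append] at hL
      exact hwa (γ.head_mem w (by rw [hL]; rfl))
    · -- predecessor `r = y = q`, contradicting self-avoidance
      rw [List.concat_eq_append] at h0
      rw [h0] at hL
      have hch' := γ.isChain
      rw [hL] at hch'
      have hrw : hexGraph.Adj r w := (List.isChain_append.1 hch').2.2 r (by simp) w (by simp)
      have hry : r = y := key r hrw.symm (by rw [hL]; simp)
      have hnd := γ.nodup
      rw [hL] at hnd
      exact (List.nodup_append.1 hnd).2.2 r (by simp) q (by simp) (hry.trans hqy.symm)

/-! ### Rigidity of the classes at the ports other than `w` -/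

/-- **Classes through a touching neighbour (non-visit as a hypothesis).** In a simply connected
`Λ` with source `a ∈ ∂Ω`: `v ∈ Λ` off `a`, `w ∈ Λ` a neighbour of `v` off `a`, `x ∉ Λ` a neighbour
of `w` other than `v`; two first arrivals `γ, γ'` at `v` through ports `p, p' ≠ w` that do not
visit `w` satisfy `W(γ) + W(p → v → w) = W(γ') + W(p' → v → w)` (double door extension to
`{w, x}` and `HexMidEdgeSAW.winding_eq_of_mem_boundary`). [folklore] -/
theorem classes_of_notMem (hΛ : hexDomainSimplyConnected Λ) (ha : a ∈ hexDomainBoundary Λ)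
    (hv : v ∈ Λ) (hva : v ∉ a) (hw : w ∈ Λ) (hwa : w ∉ a) (hvw : hexGraph.Adj v w)
    (hwx : hexGraph.Adj w x) (hxv : x ≠ v) (hx : x ∉ Λ)
    {p p' : HexVertex} (hvp : hexGraph.Adj v p) (hvp' : hexGraph.Adj v p') (hpw : p ≠ w)
    (hp'w : p' ≠ w) (γ : HexMidEdgeSAW Λ a s(v, p)) (γ' : HexMidEdgeSAW Λ a s(v, p'))
    (hvγ : v ∉ γ.verts) (hvγ' : v ∉ γ'.verts) (hwγ : w ∉ γ.verts) (hwγ' : w ∉ γ'.verts) :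
    γ.winding + winding [hexMidpoint s(p, v), hexCenter v, hexMidpoint s(v, w)] =
      γ'.winding + winding [hexMidpoint s(p', v), hexCenter v, hexMidpoint s(v, w)] := by
  obtain ⟨γ₁, e₁, h₁⟩ := exists_stepExt hv hva hvw hvp hpw γ hvγ
  obtain ⟨γ₁', e₁', h₁'⟩ := exists_stepExt hv hva hvw hvp' hp'w γ' hvγ'
  have hw₁ : w ∉ γ₁.verts := by
    rw [e₁, List.mem_append, List.mem_singleton, not_or]; exact ⟨hwγ, hvw.ne.symm⟩
  have hw₁' : w ∉ γ₁'.verts := by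
    rw [e₁', List.mem_append, List.mem_singleton, not_or]; exact ⟨hwγ', hvw.ne.symm⟩
  obtain ⟨δ₁, f₁, g₁⟩ := exists_eq_target (Sym2.eq_swap (a := v) (b := w)) γ₁
  obtain ⟨δ₁', f₁', g₁'⟩ := exists_eq_target (Sym2.eq_swap (a := v) (b := w)) γ₁'
  obtain ⟨γ₂, -, h₂⟩ := exists_doorExt hx hw hwa hwx hvw.symm hxv.symm δ₁ (f₁ ▸ hw₁)
  obtain ⟨γ₂', -, h₂'⟩ := exists_doorExt hx hw hwa hwx hvw.symm hxv.symm δ₁' (f₁' ▸ hw₁')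
  have hrig := HexMidEdgeSAW.winding_eq_of_mem_boundary hΛ ha
    (door_mem_hexDomainBoundary hx hw hwx) γ₂ γ₂'
  rw [h₂, h₂', g₁, g₁', h₁, h₁'] at hrig
  linarith

/-- **Depth-two classes at the ports other than `w`.** As above, with the neighbours `v, x, y` of
`w` given (`x ∉ Λ`): the non-visit is automatic (`notMem_of_touching`), so ANY two first arrivals
at `v` through ports `p, p' ≠ w` satisfy `W(γ) + W(p → v → w) = W(γ') + W(p' → v → w)`.
[folklore] -/
theorem depthTwo_classes (hΛ : hexDomainSimplyConnected Λ) (ha : a ∈ hexDomainBoundary Λ)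
    (hv : v ∈ Λ) (hva : v ∉ a) (hw : w ∈ Λ) (hwa : w ∉ a) (hwv : hexGraph.Adj w v)
    (hwx : hexGraph.Adj w x) (hwy : hexGraph.Adj w y) (hvx : v ≠ x) (hxy : x ≠ y) (hvy : v ≠ y)
    (hx : x ∉ Λ) {p p' : HexVertex} (hvp : hexGraph.Adj v p) (hvp' : hexGraph.Adj v p')
    (hpw : p ≠ w) (hp'w : p' ≠ w) (γ : HexMidEdgeSAW Λ a s(v, p)) (γ' : HexMidEdgeSAW Λ a s(v, p'))
    (hvγ : v ∉ γ.verts) (hvγ' : v ∉ γ'.verts) :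
    γ.winding + winding [hexMidpoint s(p, v), hexCenter v, hexMidpoint s(v, w)] =
      γ'.winding + winding [hexMidpoint s(p', v), hexCenter v, hexMidpoint s(v, w)] :=
  classes_of_notMem hΛ ha hv hva hw hwa hwv.symm hwx hvx.symm hx hvp hvp' hpw hp'w γ γ' hvγ hvγ'
    (notMem_of_touching hva hwa hwv hwx hwy hvx hxy hvy hx hpw γ hvγ)
    (notMem_of_touching hva hwa hwv hwx hwy hvx hxy hvy hx hp'w γ' hvγ')

/-! ### The class at the port `w` -/

/-- A first arrival at the port `{v, w}` of a touching neighbour `w` (off `a`) arrives from the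
third neighbour `y`: its vertex list is `L ++ [y, w]`. [folklore] -/
theorem verts_eq_of_touching (hva : v ∉ a) (hwa : w ∉ a) (hwv : hexGraph.Adj w v)
    (hwx : hexGraph.Adj w x) (hwy : hexGraph.Adj w y) (hvx : v ≠ x) (hxy : x ≠ y) (hvy : v ≠ y)
    (hx : x ∉ Λ) (γ : HexMidEdgeSAW Λ a s(v, w)) (hvγ : v ∉ γ.verts) :
    ∃ L : List HexVertex, γ.verts = L ++ [y, w] := by
  have hlast := arrival_getLast?_eq hva γ hvγ
  obtain ⟨L₀, hL₀⟩ := List.getLast?_eq_some_iff.1 hlast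
  rcases L₀.eq_nil_or_concat with h0 | ⟨L, r, h0⟩
  · rw [h0, List.nil_append] at hL₀
    exact absurd (γ.head_mem w (by rw [hL₀]; rfl)) hwa
  · rw [List.concat_eq_append] at h0
    rw [h0, List.append_assoc, List.singleton_append] at hL₀
    refine ⟨L, ?_⟩
    have hch := γ.isChain
    rw [hL₀] at hch
    have hrw : hexGraph.Adj r w := (List.isChain_cons_cons.1 (List.isChain_append.1 hch).2.1).1
    have hrΛ : r ∈ Λ := γ.subset r (by rw [hL₀]; simp)
    have hrv : r ≠ v := fun h => hvγ (by rw [hL₀, ← h]; simp)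
    rcases adj_cases hwv hwx hwy hvx hxy hvy hrw.symm with h | h | h
    · exact absurd h hrv
    · exact absurd (h ▸ hrΛ) hx
    · rw [hL₀, h]

/-- **Re-targeting the last half-edge.** A first arrival `γ` at the port `{v, w}` (vertex list
`L ++ [y, w]`, `w` off `a`, `x ∉ Λ` a neighbour of `w`) is also a walk from `a` to the door
`{w, x}` with the same vertices, whose winding differs by the exchange of the last turning angle:
`W' = W(γ) − turn(c(y), c(w), mid{v,w}) + turn(c(y), c(w), mid{w,x})`. [folklore] -/
theorem exists_retarget (hwa : w ∉ a) (hx : x ∉ Λ) (γ : HexMidEdgeSAW Λ a s(v, w))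
    {L : List HexVertex} (hL : γ.verts = L ++ [y, w]) :
    ∃ γ' : HexMidEdgeSAW Λ a s(w, x), γ'.verts = γ.verts ∧
      γ'.winding = γ.winding - winding [hexCenter y, hexCenter w, hexMidpoint s(v, w)] +
        winding [hexCenter y, hexCenter w, hexMidpoint s(w, x)] := by
  have hne : γ.verts ≠ [] := by rw [hL]; simp
  have hlast : γ.verts.getLast? = some w := by
    rw [hL, List.getLast?_append, show [y, w].getLast? = some w from rfl, Option.some_or]
  refine ⟨⟨γ.verts, γ.subset, γ.nodup, γ.isChain, γ.head_mem, ?_, fun h => absurd h hne,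
    fun _ => ?_, γ.fst_mem⟩, rfl, ?_⟩
  · intro z hz
    rw [hlast, Option.some.injEq] at hz
    rw [← hz]; exact Sym2.mem_mk_left w x
  · -- edges: the new final half-edge `{w, x}` is not `a` (`w ∉ a`) and not a step (`x ∉ Λ`)
    have hold := γ.edges_nodup hne
    rw [List.nodup_append] at hold ⊢
    refine ⟨hold.1, List.nodup_singleton _, fun e he f hf => ?_⟩
    rw [List.mem_singleton] at hf
    subst hf
    rcases List.mem_cons.1 he with rfl | he
    · intro h; exact hwa (by rw [h]; exact Sym2.mem_mk_left w x)
    · rintro rfl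
      exact hx (γ.subset x (forall_mem_of_mem_edges _ _ he x (Sym2.mem_mk_right w x)))
  · -- the winding: exchange the last turning angle
    change Literature.Probability.LatticeModels.winding
        (hexMidpoint a :: γ.verts.map hexCenter ++ [hexMidpoint s(w, x)]) = _
    rw [HexMidEdgeSAW.winding, HexMidEdgeSAW.points, hL]
    simp only [List.map_append, List.map_cons, List.map_nil, List.cons_append, List.append_assoc,
      List.nil_append]
    rw [show hexMidpoint a :: (L.map hexCenter ++ [hexCenter y, hexCenter w, hexMidpoint s(w, x)]) =
        (hexMidpoint a :: L.map hexCenter) ++ [hexCenter y, hexCenter w, hexMidpoint s(w, x)] from rfl,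
      show hexMidpoint a :: (L.map hexCenter ++ [hexCenter y, hexCenter w, hexMidpoint s(v, w)]) =
        (hexMidpoint a :: L.map hexCenter) ++ [hexCenter y, hexCenter w, hexMidpoint s(v, w)] from rfl,
      winding_concat₃, winding_concat₃]
    simp only [winding_cons_cons_cons, winding_pair, add_zero]
    ring

/-- **Depth-two class at the port `w`.** With `v, w, x, y` as above (`Λ` simply connected, source
`a ∈ ∂Ω`, `v, w` off `a`, `x ∉ Λ`): a first arrival `γ_w` at the port `{v, w}` and a first arrival
`γ` at a port `p ≠ w` satisfy
`W(γ_w) − turn(c y, c w, mid{v,w}) + turn(c y, c w, mid{w,x}) = W(γ) + W(p → v → w) + W(v → w → x)`: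
both sides are windings of walks from `a` to the boundary mid-edge `{w, x}`. [folklore] -/
theorem depthTwo_portClass (hΛ : hexDomainSimplyConnected Λ) (ha : a ∈ hexDomainBoundary Λ)
    (hv : v ∈ Λ) (hva : v ∉ a) (hw : w ∈ Λ) (hwa : w ∉ a) (hwv : hexGraph.Adj w v)
    (hwx : hexGraph.Adj w x) (hwy : hexGraph.Adj w y) (hvx : v ≠ x) (hxy : x ≠ y) (hvy : v ≠ y)
    (hx : x ∉ Λ) {p : HexVertex} (hvp : hexGraph.Adj v p) (hpw : p ≠ w)
    (γw : HexMidEdgeSAW Λ a s(v, w)) (γ : HexMidEdgeSAW Λ a s(v, p))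
    (hvγw : v ∉ γw.verts) (hvγ : v ∉ γ.verts) :
    γw.winding - winding [hexCenter y, hexCenter w, hexMidpoint s(v, w)] +
        winding [hexCenter y, hexCenter w, hexMidpoint s(w, x)] =
      γ.winding + winding [hexMidpoint s(p, v), hexCenter v, hexMidpoint s(v, w)] +
        winding [hexMidpoint s(v, w), hexCenter w, hexMidpoint s(w, x)] := by
  obtain ⟨L, hL⟩ := verts_eq_of_touching hva hwa hwv hwx hwy hvx hxy hvy hx γw hvγw
  obtain ⟨γw', -, hw'⟩ := exists_retarget hwa hx γw hL
  have hwγ : w ∉ γ.verts := notMem_of_touching hva hwa hwv hwx hwy hvx hxy hvy hx hpw γ hvγ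
  obtain ⟨γ₁, e₁, h₁⟩ := exists_stepExt hv hva hwv.symm hvp hpw γ hvγ
  have hw₁ : w ∉ γ₁.verts := by
    rw [e₁, List.mem_append, List.mem_singleton, not_or]; exact ⟨hwγ, hwv.ne⟩
  obtain ⟨δ₁, f₁, g₁⟩ := exists_eq_target (Sym2.eq_swap (a := v) (b := w)) γ₁
  obtain ⟨γ₂, -, h₂⟩ := exists_doorExt hx hw hwa hwx hwv hvx δ₁ (f₁ ▸ hw₁)
  have hrig := HexMidEdgeSAW.winding_eq_of_mem_boundary hΛ ha
    (door_mem_hexDomainBoundary hx hw hwx) γw' γ₂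
  rw [hw', h₂, g₁, h₁] at hrig
  linarith

/-- **Helper (registered form of `depthTwo_classes`).** [folklore] -/
theorem helper_depthTwoClasses :
    ∀ (Λ : Finset HexVertex), hexDomainSimplyConnected Λ → ∀ a ∈ hexDomainBoundary Λ,
      ∀ (v w x y : HexVertex), v ∈ Λ → v ∉ a → w ∈ Λ → w ∉ a → hexGraph.Adj w v →
      hexGraph.Adj w x → hexGraph.Adj w y → v ≠ x → x ≠ y → v ≠ y → x ∉ Λ →
      ∀ (p p' : HexVertex), hexGraph.Adj v p → hexGraph.Adj v p' → p ≠ w → p' ≠ w →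
      ∀ (γ : HexMidEdgeSAW Λ a s(v, p)) (γ' : HexMidEdgeSAW Λ a s(v, p')),
        v ∉ γ.verts → v ∉ γ'.verts →
        γ.winding + winding [hexMidpoint s(p, v), hexCenter v, hexMidpoint s(v, w)] =
          γ'.winding + winding [hexMidpoint s(p', v), hexCenter v, hexMidpoint s(v, w)] :=
  fun _ hΛ _ ha _ _ _ _ hv hva hw hwa hwv hwx hwy hvx hxy hvy hx _ _ hvp hvp' hpw hp'w γ γ' hvγ hvγ' =>
    depthTwo_classes hΛ ha hv hva hw hwa hwv hwx hwy hvx hxy hvy hx hvp hvp' hpw hp'w γ γ' hvγ hvγ'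

end Summit.CriticalPhenomena.SAWScalingLimit.Theorems.SAWDevelopingMapNoFoldBound

end
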